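import Mathlib
import HarnessLib
import Summits.HubbardSuperconductivity.HubbardSuperconductivity.Theorems.KLProgrammeKLRegimeCountertermOneVolumeH
import Summits.HubbardSuperconductivity.HubbardSuperconductivity.Theorems.KLProgrammeKLRegimeSplitBundleV12

/-!
# Route `KLProgramme` — child `KLRegimeCounterterm` of crux K3 FOR EVERY BUNDLE OF THE V11 SHAPE
# (`CountertermP2 Pr klWindowC`: gen 3 `klPredsV11` = stmt-HubbardSuperconductivity-19825 (closed), gen 4 `klPredsV12`, …) — seat hubbard-kl-k3c3-p2

**`countertermP2_of_twoLegShape`.**  Let `Pr : Preds` be any predicate bundle such that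
* `FrameOK → Pr.frameOK` (child 2 offers `FrameOK` frames for its package `ctRenMs G`),
* `RenormalisedAtF → Pr.renorm`,
* the comparison-frame HISTORY `H` of the two-leg slot is implied by `Pr.split ∧ RenormalisedAtF ∧ Pr.engine` at the scale (any engine
  slot, any split slot: `histV10` for `klPredsV11`, `histV12` for `klPredsV12`, …),
* the (E3f) comparison-volume ANTECEDENT `A` is implied by `H ∧ Pr.twoLeg` at the scale,
* `Pr.twoLeg → TwoLegStepG H ∧ TwoLegSizesMS ∧ TwoLegAngularG ∧ TwoLegVolumeRate A` (the V11 shape: (E3a) two-tier + (E3a-MS), (E3b), (E3c)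
  keyed on `H`, slopes, (E3g), (E3f) keyed on `A`).
Then `CountertermP2 Pr klWindowC` holds: package `ctRenMs G` (Δ8: a function of `G`), constants and ONE construction volume from
`ct_oneVolume_thresholdsH` (chosen before the hypothesis block is seen), the admissible half-tolerance frame from the history-generic wholesale
continuation (`…CountertermContinuationH` / `…CountertermOneVolumeH`), and the VOLUME TRANSFER by (E3f) (`ct_volumeTransfer_of_rate`,
`…CountertermV11Volume` §Ms verbatim up to the shape).  The engine and split slots enter ONLY as bookkeeping of `H` and `A`.

Instances (both `example`s, identity maps): `klPredsV11` (gen 3, closed by `KLRegimeCounterterm.KLRegimeCountertermV11_of`) and `klPredsV12`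
(gen 4; the same statement is landed as `CtE.countertermP2_klPredsV12` by k3c5-p1's DEFEQ-generic chain `klPredsE E` —
`…SplitTwoLegStepE` / `…CountertermBlockE` / `…ContinuationE` / `…OneVolumeMsE` / `…CountertermV12Body`).  The present theorem is the
IMPLICATION-generic twin: it survives a bundle whose two-leg slot is typed in a different shape or with EXTRA conjuncts (the `rfl` re-packaging
does not), so it is the port vehicle for any later generation.  Proofs only; nothing is asserted about the Hubbard model beyond the hypothesis
blocks.
-/

noncomputable section

namespace Summit.HubbardSuperconductivity.HubbardSuperconductivity.Theorems.KLRegimeSplit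

set_option linter.dupNamespace false -- summit = problem name (single-conjunct summit), D-0017

open Real Finset
open Literature.MathematicalPhysics.QuantumLattice Literature.Probability.LatticeModels
open Summit.HubbardSuperconductivity.HubbardSuperconductivity.Theorems.KLProgrammeLegKernels

/-! ## §1 The volume transfer from a rate -/

/-- **VOLUME TRANSFER from a rate** (`ct_volumeTransferMsV11` verbatim up to the source of the rate): if at the construction volume
`(L₀, M₀)` the frame `K` is within HALF tolerance at every scale with `CL n / L₀` in the other half, and at every target volume `(L, M)`
beyond `(L₀, Mc)` the renormalisation of `K` below `n` there yields the rate `|ν_n^{L₀,M₀}(θ) − ν_n^{L,M}(θ)| ≤ CL n / L₀`, then `K` is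
renormalised (package `R`, tolerance `cr = ctCr G`) at every scale at every such volume — strong induction on the scale. -/
theorem ct_volumeTransfer_of_rate {G : GeoConsts} {R : RenConsts} (hcr : R.cr = ctCr G) {β U μ : ℝ} {CL : ℕ → ℝ}
    {K : TrigPolyC4v} {L₀ M₀ : ℕ} [NeZero L₀] [NeZero M₀] {Mc : ℕ → ℕ}
    (rate : ∀ (L M : ℕ) [NeZero L] [NeZero M], L₀ ≤ L → Mc L ≤ M → ∀ n : ℕ, n ≤ nScales β →
      (∀ j < n, RenormalisedAtF L M β U μ K R j) →
        ∀ θ : ℝ, |klLocalPart L₀ M₀ β U μ K n θ - klLocalPart L M β U μ K n θ| ≤ CL n / L₀)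
    (hhalf : ∀ n : ℕ, n ≤ nScales β →
      (∀ θ : ℝ, |klLocalPart L₀ M₀ β U μ K n θ| ≤ ctCr G * |U| * klScale klE0 n ^ 2 / klE0 / 2) ∧
      CL n / L₀ ≤ ctCr G * |U| * klScale klE0 n ^ 2 / klE0 / 2) :
    ∀ (L M : ℕ) [NeZero L] [NeZero M], L₀ ≤ L → Mc L ≤ M →
      ∀ n : ℕ, n ≤ nScales β → RenormalisedAtF L M β U μ K R n := by
  intro L M _ _ hL hM n
  induction n using Nat.strong_induction_on with
  | _ n ih =>
    intro hn θ
    have hrenL : ∀ j < n, RenormalisedAtF L M β U μ K R j := fun j hj => ih j hj (le_of_lt (lt_of_lt_of_le hj hn))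
    have hrate := rate L M hL hM n hn hrenL θ
    have hhalfθ := (hhalf n hn).1 θ
    have hCL := (hhalf n hn).2
    show |klLocalPart L M β U μ K n θ| ≤ R.cr * |U| * klScale klE0 n ^ 2 / klE0
    rw [hcr]
    have htri : |klLocalPart L M β U μ K n θ| ≤
        |klLocalPart L₀ M₀ β U μ K n θ| + |klLocalPart L₀ M₀ β U μ K n θ - klLocalPart L M β U μ K n θ| := by
      have h1 := abs_sub_abs_le_abs_sub (klLocalPart L M β U μ K n θ) (klLocalPart L₀ M₀ β U μ K n θ)
      rw [abs_sub_comm] at h1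
      linarith
    linarith

/-! ## §2 `CountertermP2` for every bundle of the V11 shape -/

section Shape

variable {Pr : Preds}

/-- **CHILD COUNTERTERM FOR EVERY BUNDLE OF THE V11 SHAPE.**  See the module docstring: `H` is the comparison-frame history of the
two-leg slot (implied by `split ∧ renorm ∧ engine`), `A` the (E3f) comparison-volume antecedent (implied by `H ∧ twoLeg`); the engine and
split slots of `Pr` are otherwise arbitrary.  Conclusion: `CountertermP2 Pr klWindowC` — ONE admissible frame, chosen before the volume,
renormalised at every scale and every large volume. -/
theorem countertermP2_of_twoLegShape
    (H A : (L M : ℕ) → [NeZero L] → [NeZero M] → GeoConsts → SplitConsts → EngConsts → RenConsts → ℝ → ℝ → ℝ →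
      TrigPolyC4v → ℕ → Prop)
    (hF : ∀ (R : RenConsts) (U : ℝ) (N : ℕ) (μ : ℝ) (K : TrigPolyC4v), FrameOK R U N μ K → Pr.frameOK R U N μ K)
    (hR : ∀ (L M : ℕ) [NeZero L] [NeZero M] (β U μ : ℝ) (K : TrigPolyC4v) (R : RenConsts) (n : ℕ),
      RenormalisedAtF L M β U μ K R n → Pr.renorm L M β U μ K R n)
    (hH : ∀ (L M : ℕ) [NeZero L] [NeZero M] (G : GeoConsts) (P : SplitConsts) (Q : EngConsts) (R : RenConsts) (β U μ : ℝ)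
      (K : TrigPolyC4v) (n : ℕ), Pr.split L M G P Q β U μ K n → RenormalisedAtF L M β U μ K R n →
        Pr.engine L M G P Q β U μ K n → H L M G P Q R β U μ K n)
    (hA : ∀ (L M : ℕ) [NeZero L] [NeZero M] (G : GeoConsts) (P : SplitConsts) (Q : EngConsts) (R : RenConsts) (β U μ : ℝ)
      (K : TrigPolyC4v) (n : ℕ), H L M G P Q R β U μ K n → Pr.twoLeg L M G P Q R β U μ K n → A L M G P Q R β U μ K n)
    (hT : ∀ (L M : ℕ) [NeZero L] [NeZero M] (G : GeoConsts) (P : SplitConsts) (Q : EngConsts) (R : RenConsts) (β U μ : ℝ)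
      (K : TrigPolyC4v) (n : ℕ), Pr.twoLeg L M G P Q R β U μ K n →
        TwoLegStepG L M (H L M G P Q R β U μ) G P Q R β U μ K n ∧ TwoLegSizesMS L M G Q R β U μ K n ∧
          TwoLegAngularG L M G Q R β U μ K n ∧
            TwoLegVolumeRate L M (fun L' M' _ _ K' j => A L' M' G P Q R β U μ K' j) Q β U μ K n) :
    CountertermP2 Pr klWindowC := by
  intro G P hG _
  refine ⟨ctRenMs G, ctRenMs_WF2 hG, fun Q hQ => ?_⟩
  obtain ⟨c₁, hc₁, hc⟩ := ct_oneVolume_thresholdsH G Q hG hQ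
  refine ⟨c₁, hc₁, fun c hc0 hcc => ?_⟩
  obtain ⟨U₀, hU₀, hmain⟩ := hc c hc0 hcc
  refine ⟨U₀, hU₀, fun μ hμ U hU hUle β hβ hβc Lh Mh hhyp => ?_⟩
  have hCL : ∀ n, 0 ≤ Q.CL β n := fun n => hQ.2.2.2.2.2.2.2 β n
  obtain ⟨L₀, M₀, hL₀pos, hM₀pos, hLh, hMh, hM0, hrate, hvol⟩ :=
    hmain μ hμ U hU hUle β hβ hβc Lh Mh (Q.M0 β) (Q.CL β) hCL
  haveI : NeZero L₀ := ⟨Nat.pos_iff_ne_zero.mp hL₀pos⟩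
  haveI : NeZero M₀ := ⟨Nat.pos_iff_ne_zero.mp hM₀pos⟩
  -- the history-keyed block at any volume beyond the thresholds, from the hypothesis block of `CountertermP2`
  have blkAt : ∀ (L M : ℕ) [NeZero L] [NeZero M], Lh ≤ L → Mh L ≤ M →
      ∀ K : TrigPolyC4v, FrameOK (ctRenMs G) U (nScales β) μ K → ∀ n : ℕ, n ≤ nScales β →
        (∀ j < n, RenormalisedAtF L M β U μ K (ctRenMs G) j) →
          TwoLegStepG L M (H L M G P Q (ctRenMs G) β U μ) G P Q (ctRenMs G) β U μ K n ∧
            TwoLegSizesMS L M G Q (ctRenMs G) β U μ K n ∧ TwoLegAngularG L M G Q (ctRenMs G) β U μ K n ∧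
              (RenormalisedAtF L M β U μ K (ctRenMs G) n → H L M G P Q (ctRenMs G) β U μ K n) := by
    intro L M _ _ hL hM K hK n hn hren
    obtain ⟨hE, hTw, hS⟩ := hhyp K (hF _ _ _ _ _ hK) L M hL hM n hn fun j hj => hR _ _ _ _ _ _ _ _ (hren j hj)
    have ht := hT _ _ _ _ _ _ _ _ _ _ _ hTw
    exact ⟨ht.1, ht.2.1, ht.2.2.1, fun hr => hH _ _ _ _ _ _ _ _ _ _ _ hS hr hE⟩
  -- the one-volume construction at `(L₀, M₀)`
  obtain ⟨K, hK, hhalf⟩ := hvol inferInstance inferInstance P (H L₀ M₀ G P Q (ctRenMs G) β U μ) (blkAt L₀ M₀ hLh hMh)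
  refine ⟨K, hF _ _ _ _ _ hK, L₀, fun L => max (Mh L) (Q.M0 β L), fun L M _ _ hL hM n hn => hR _ _ _ _ _ _ _ _ ?_⟩
  -- renormalisation at the construction volume, at every scale (half tolerance ≤ tolerance)
  have htol_nonneg : ∀ n, 0 ≤ ctCr G * |U| * klScale klE0 n ^ 2 / klE0 / 2 := by
    intro n
    have hS : ∀ j, 0 ≤ G.S j := hG.2.2.2.2.2.2.2.2.2.2.2.2.2.2.2.2.2.1
    have hcr : 0 ≤ ctCr G := by unfold ctCr; nlinarith [hS 0]
    have he0 : (0:ℝ) < klE0 := by norm_num [klE0]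
    positivity
  have hren0 : ∀ n, n ≤ nScales β → RenormalisedAtF L₀ M₀ β U μ K (ctRenMs G) n := by
    intro n hn θ
    have h := hhalf n hn θ
    show |klLocalPart L₀ M₀ β U μ K n θ| ≤ ctCr G * |U| * klScale klE0 n ^ 2 / klE0
    linarith [htol_nonneg n]
  -- the (E3f) comparison-volume antecedent at any volume beyond the thresholds carrying the renormalisation below the scale
  have hAnte : ∀ (L' M' : ℕ) [NeZero L'] [NeZero M'], Lh ≤ L' → Mh L' ≤ M' → ∀ n : ℕ, n ≤ nScales β →
      (∀ j < n, RenormalisedAtF L' M' β U μ K (ctRenMs G) j) → ∀ j < n, A L' M' G P Q (ctRenMs G) β U μ K j := by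
    intro L' M' _ _ hL' hM' n hn hren j hj
    obtain ⟨hE, hTw, hS⟩ := hhyp K (hF _ _ _ _ _ hK) L' M' hL' hM' j (le_of_lt (lt_of_lt_of_le hj hn))
      fun i hi => hR _ _ _ _ _ _ _ _ (hren i (hi.trans hj))
    exact hA _ _ _ _ _ _ _ _ _ _ _ (hH _ _ _ _ _ _ _ _ _ _ _ hS (hren j hj) hE) hTw
  -- the rate between the construction volume and any larger volume
  have rate : ∀ (L M : ℕ) [NeZero L] [NeZero M], L₀ ≤ L → max (Mh L) (Q.M0 β L) ≤ M → ∀ n : ℕ, n ≤ nScales β →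
      (∀ j < n, RenormalisedAtF L M β U μ K (ctRenMs G) j) →
        ∀ θ : ℝ, |klLocalPart L₀ M₀ β U μ K n θ - klLocalPart L M β U μ K n θ| ≤ Q.CL β n / L₀ := by
    intro L M _ _ hL hM n hn hrenL θ
    have hMhL : Mh L ≤ M := (le_max_left _ _).trans hM
    have hM0L : Q.M0 β L ≤ M := (le_max_right _ _).trans hM
    obtain ⟨_, hTw, _⟩ := hhyp K (hF _ _ _ _ _ hK) L₀ M₀ hLh hMh n hn
      fun j hj => hR _ _ _ _ _ _ _ _ (hren0 j (le_of_lt (lt_of_lt_of_le hj hn)))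
    have hvr := (hT _ _ _ _ _ _ _ _ _ _ _ hTw).2.2.2
    exact hvr hM0 L M hL hM0L (hAnte L M (hLh.trans hL) hMhL n hn hrenL) θ
  exact ct_volumeTransfer_of_rate (G := G) (R := ctRenMs G) rfl rate (fun n hn => ⟨hhalf n hn, hrate n hn⟩) L M hL hM n hn

end Shape

/-! ## §3 Instances: gen 3 (`klPredsV11`, closed) and gen 4 (`klPredsV12`) -/

/-- Gen 3 re-derived from the shape (the child of record is closed by `KLRegimeCounterterm.KLRegimeCountertermV11_of`; this `example` documents
that the shape hypotheses are the identity maps for `klPredsV11`, `H = histV10`). -/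
example : CountertermP2 klPredsV11 klWindowC :=
  countertermP2_of_twoLegShape (Pr := klPredsV11) (fun L M _ _ G P Q R β U μ K j => histV10 L M G P Q R β U μ K j)
    (fun L M _ _ G P Q R β U μ K j => histV10 L M G P Q R β U μ K j ∧
      TwoLegStepG L M (histV10 L M G P Q R β U μ) G P Q R β U μ K j ∧ TwoLegSizesMS L M G Q R β U μ K j ∧
        TwoLegAngularG L M G Q R β U μ K j)
    (fun _ _ _ _ _ h => h) (fun _ _ _ _ _ _ _ _ _ _ h => h) (fun _ _ _ _ _ _ _ _ _ _ _ _ _ hs hr he => ⟨hs, hr, he⟩)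
    (fun _ _ _ _ _ _ _ _ _ _ _ _ _ hh ht => ⟨hh, ht.1, ht.2.1, ht.2.2.1⟩) (fun _ _ _ _ _ _ _ _ _ _ _ _ _ h => h)

/-- **The gen-4 Counterterm child's statement `CountertermP2 klPredsV12 klWindowC`** (`klPredsV12` = `…SplitBundleV12`, engine slot
`EngineBoundsAtV8S` (Δ21 (R-w′)), history `histV12`, two-leg slot `TwoLegStepV12` of the V11 shape) re-derived from `countertermP2_of_twoLegShape`
with `H = histV12` and the identity maps.  An `example`, not a theorem: the same statement is landed as `CtE.countertermP2_klPredsV12`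
(`…CountertermV12Body`, k3c5-p1's defeq-generic chain `klPredsE`); the route decl `KLRegimeCountertermV12` is closed by name from either. -/
example : CountertermP2 klPredsV12 klWindowC :=
  countertermP2_of_twoLegShape (Pr := klPredsV12) (fun L M _ _ G P Q R β U μ K j => histV12 L M G P Q R β U μ K j)
    (fun L M _ _ G P Q R β U μ K j => histV12 L M G P Q R β U μ K j ∧
      TwoLegStepG L M (histV12 L M G P Q R β U μ) G P Q R β U μ K j ∧ TwoLegSizesMS L M G Q R β U μ K j ∧
        TwoLegAngularG L M G Q R β U μ K j)
    (fun _ _ _ _ _ h => h) (fun _ _ _ _ _ _ _ _ _ _ h => h) (fun _ _ _ _ _ _ _ _ _ _ _ _ _ hs hr he => ⟨hs, hr, he⟩)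
    (fun _ _ _ _ _ _ _ _ _ _ _ _ _ hh ht => ⟨hh, ht.1, ht.2.1, ht.2.2.1⟩) (fun _ _ _ _ _ _ _ _ _ _ _ _ _ h => h)

end Summit.HubbardSuperconductivity.HubbardSuperconductivity.Theorems.KLRegimeSplit

end
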